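import Literature.NumberTheory.EllipticCurves.HidaFamilyMembersProofs
import Literature.NumberTheory.EllipticCurves.CuspFormLFunctionCriticalNonvanishingProofs
import Literature.NumberTheory.EllipticCurves.PAdicLFunctionDistributionProofs
import Literature.NumberTheory.EllipticCurves.Rank1Residual.Predicates
import HarnessLib

/-!
# Crux `KobayashiLowerHalfLargeImage` (item stmt-BirchSwinnertonDyer-19001), idea `edge-seed-rigidity`:
# its first stub `stub_companionEdge` — the weight-`p+1` COMPANION NEWFORM `g ≡ f_E (mod 𝔭)` with
# `L(g, p) ≠ 0` — PROVED at every prime `p ≥ 5` (and in every weight `≡ 2 (mod p − 1)`)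

HONEST FRAMING (D-0152). Route K3 = `SignedLowerHalves` is a CLASS route; crux 3
(`Theses.SignedLowerHalves.KobayashiLowerHalfLargeImage`) is the Eisenstein half of Kobayashi's signed
main conjecture on the large-image corner of X7. NOTHING here proves the crux, the route, or BSD. This
file is a HELPER of item 19001 (`--supports`): it puts IN THE KERNEL the first stub `S1 =
stub_companionEdge` of the (unregistered, PREVIEW) line `Lines/edge_seed_rigidity.md` of the crux
directory (idea card `Ideas/edge-seed-rigidity.md`, crux-ideate k1 g14), at every prime `p ≥ 5`, by
COMPOSING theorems already PROVED in the tree — no named fact, no `sorry`, no new definition: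

* `ModularForms.exists_isNewform0_dvd_level_congr` (`HidaFamilyMembersProofs`; Deligne–Serre 1974,
  6.9–6.11: `f · E_w`, `E_w ≡ 1 (mod p)`, the lifting lemma; Atkin–Lehner–Li: the eigenpacket of the
  lift is that of a newform of level `M ∣ N`) — for a newform `f ∈ S_2(Γ₀(N))`, ANY prime `p`, any
  even `w ≥ 3` with `(p − 1) ∣ w`: a newform `g ∈ S_{2+w}(Γ₀(M))`, `M ∣ N`, with
  `a_q(g) ≡ a_q(f) (mod 𝔪_{ℚ̄_p})` for every prime `q ∤ N` (NO ordinarity hypothesis — this is the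
  point: the crux lives at SUPERSINGULAR `p`, `a_p(E) = 0`);
* `ModularForms.IsNewform0.cuspFormLSeries_ne_zero` (`CuspFormLFunctionCriticalNonvanishingProofs`;
  Diamond–Shurman Thm. 5.9.2): `L(g, s) ≠ 0` for `re s > k/2 + 1`;
* the modularity dictionary `a_ℓ(f_E) = a_ℓ(E)` (`IsNewformOf`, `LFunction_apply_prime_eq_frobeniusTrace`),
  `p ∤ N` at a good `p` (`not_dvd_level_of_isNewformOf`), `ℓ ∤ N ⇒` good at `ℓ`
  (`hasGoodReductionAtPrime_of_not_dvd_conductorNorm`), `T_ℓ g = a_ℓ(g) g`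
  (`IsNewform0.heckeEigenvalue_eq_coeff_holds`), and `ℚ̄_p ≃ ℂ` (`PadicAlgCl.nonempty_ringEquiv_complex`).

## Statements

* `exists_companion_newform_of_isNewformOf` — GENERAL WEIGHT, unconditional: for `E = W/ℚ` (globally
  minimal), a prime `p` of good reduction, the newform `f` of `W` (`IsNewformOf W f`) and an even `w ≥ 3`
  with `(p − 1) ∣ w`, there are `M ∣ N_E`, a newform `g ∈ S_{2+w}(Γ₀(M))` and `ι : ℚ̄_p ≃ ℂ` with
  `p ∤ M`, `‖ι⁻¹ a_ℓ(g) − a_ℓ(E)‖ < 1` for every prime `ℓ ∤ N_E` (`a_ℓ(g)` = the `T_ℓ`-eigenvalue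
  `heckeEigenvalue g ℓ`), and `L(g, s) ≠ 0` whenever `re s > w/2 + 2`; in particular at the EDGE
  critical value `s = 1 + w` as soon as `w > 2`.
* `exists_companionEdge_of_isNewformOf_of_five_le` — the EDGE case `w = p − 1`, `p ≥ 5`: a companion
  newform of weight `p + 1` with `L(g, p) ≠ 0` (`(p+1)/2 + 1 < p ⟺ p > 3`).
* `stub_companionEdge_of_five_le_of_exists_isNewformOf` — the ideator's stub `stub_companionEdge`
  VERBATIM (its two definitions `IsCompanionForm` / `IsCongruentFormModP` of the evidence file
  `Sketch.lean` UNFOLDED, since they are not tree definitions), with `p ≠ 2` strengthened to `5 ≤ p`,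
  GRANTED ONLY the Modularity Theorem as the tree's named fact `ModularForms.exists_isNewformOf`
  (Breuil–Conrad–Diamond–Taylor 2001, Thm. A) — needed because the stub quantifies over `W` without
  naming its newform. The displayed hypotheses `ClassX7 W p` (used only through good reduction at `p`),
  `a_p = 0` and `Surj W p` are the crux's; the last two are idle here (honest: S1 does not need them).

## What is NOT proved here (said, not hidden)

* `p = 3`: the stub asks for a companion of weight `p + 1 = 4`, i.e. `w = 2`; the tree's Deligne–Serre
  step multiplies by the level-one Eisenstein series `E_w`, which needs `w ≥ 4` (`E_2` is not modular);
  the weight-`4` companion at `p = 3` needs the Hasse invariant / `θ`-cycle (Katz–Serre) or a level-`N`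
  weight-`2` Eisenstein lift, neither in the tree. The general-weight theorem DOES give companions of
  weights `6, 8, 10, …` at `p = 3` (every even `w ≥ 4`), each with `L(g, 1+w) ≠ 0` — the «thin edge»
  variant S2′ of the line card is served at `p = 3` too, the literal S1 is not.
* Nothing about the ENGINE S2 (Harder's congruence at `p = j + 3`, paramodular level, to depth `e(g)`),
  S3 (height-`p` lattice), S4 (Kato edge rigidity), S5 (Fouquet transport): NOT in print at these
  parameters / not typed (definition requests D1/D2 of the line card). This file is calibration of S1 only.

References: Deligne–Serre 1974, 6.9–6.11 [DeligneSerreASENS1974]; Diamond–Shurman GTM 228, Thms. 5.8.2–5.8.3,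
5.9.2 [DiamondShurman2005]; Breuil–Conrad–Diamond–Taylor 2001, Thm. A [BreuilConradDiamondTaylor2001];
crux workfiles `Cruxes/KobayashiLowerHalfLargeImage/{Ideas/edge-seed-rigidity.md, Lines/edge_seed_rigidity.md}`.
-/

set_option autoImplicit false
set_option linter.dupNamespace false

noncomputable section

open scoped MatrixGroups ModularForm

open CongruenceSubgroup UpperHalfPlane WeierstrassCurve
  Literature.NumberTheory.EllipticCurves Literature.NumberTheory.EllipticCurves.ModularForms
  Literature.NumberTheory.EllipticCurves.Rank1Residual

namespace Summit.BirchSwinnertonDyer.BirchSwinnertonDyer.Theorems.EdgeSeedRigidity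

/-- **Companion newforms of `f_E` in every weight `≡ 2 (mod p − 1)`, with non-vanishing edge
`L`-values** (unconditional). Let `W/ℚ` be a globally minimal elliptic curve of conductor `N`, `p` a
prime of good reduction, `f ∈ S_2(Γ₀(N))` the newform of `W` (`IsNewformOf W f`) and `w ≥ 3` even with
`(p − 1) ∣ w`. Then there are a level `M ∣ N` with `p ∤ M`, a newform `g ∈ S_{2+w}(Γ₀(M))` and a field
isomorphism `ι : ℚ̄_p ≃ ℂ` such that `‖ι⁻¹(a_ℓ(g)) − a_ℓ(W)‖_p < 1` for every prime `ℓ ∤ N` (`a_ℓ(g)` the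
`T_ℓ`-eigenvalue, `a_ℓ(W)` the Frobenius trace), and `L(g, s) ≠ 0` for `re s > w/2 + 2`. Deligne–Serre
6.9–6.11 + Atkin–Lehner–Li (`exists_isNewform0_dvd_level_congr`), the modularity dictionary, and the
Euler-product half-plane (`IsNewform0.cuspFormLSeries_ne_zero`).
[cite: DeligneSerreASENS1974, 6.9–6.11] [cite: DiamondShurman2005, Thm. 5.8.3 and Thm. 5.9.2] -/
theorem exists_companion_newform_of_isNewformOf (W : WeierstrassCurve ℚ) [W.IsElliptic]
    [W.IsGloballyMinimal] [NeZero (W.conductorNorm ℤ)] (p : ℕ) [Fact p.Prime]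
    (hgood : W.HasGoodReductionAtPrime p)
    {f : CuspForm (Gamma0 (W.conductorNorm ℤ)) 2} (hf : IsNewformOf W f)
    {w : ℕ} (hw3 : 3 ≤ w) (hwe : Even w) (hpw : (p - 1) ∣ w) :
    ∃ (M : ℕ) (_ : NeZero M) (_ : M ∣ W.conductorNorm ℤ) (g : CuspForm (Gamma0 M) (2 + (w : ℤ)))
      (ι : PadicAlgCl p ≃+* ℂ),
      IsNewform0 g ∧ ¬ p ∣ M ∧
      (∀ ℓ : ℕ, ℓ.Prime → ¬ ℓ ∣ W.conductorNorm ℤ →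
        ‖ι.symm (heckeEigenvalue g ℓ) - ((W.frobeniusTrace ℓ : ℤ) : PadicAlgCl p)‖ < 1) ∧
      (∀ s : ℂ, (w : ℝ) / 2 + 2 < s.re → cuspFormLSeries g s ≠ 0) := by
  -- an abstract field isomorphism `ℚ̄_p ≃ ℂ`
  obtain ⟨ι⟩ := PadicAlgCl.nonempty_ringEquiv_complex p
  -- good reduction at `p` forces `p ∤ N`
  have hpN : ¬ p ∣ W.conductorNorm ℤ := not_dvd_level_of_isNewformOf hf hgood
  -- Deligne–Serre + Atkin–Lehner–Li: the congruent newform of weight `2 + w` and level `M ∣ N`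
  obtain ⟨M, hM, hMN, g, hg, hcong⟩ :=
    exists_isNewform0_dvd_level_congr ι le_rfl hf.1 hw3 hwe hpw
  refine ⟨M, hM, hMN, g, ι, hg, fun h => hpN (h.trans hMN), fun ℓ hℓ hℓN => ?_, fun s hs => ?_⟩
  · -- the modularity dictionary at the good prime `ℓ ∤ N`: `a_ℓ(f) = a_ℓ(W)`
    haveI : Fact ℓ.Prime := ⟨hℓ⟩
    have hgoodℓ : W.HasGoodReductionAtPrime ℓ :=
      hasGoodReductionAtPrime_of_not_dvd_conductorNorm W hℓN
    have hfℓ : (qExpansion 1 ⇑f).coeff ℓ = ((W.frobeniusTrace ℓ : ℤ) : ℂ) := by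
      rw [← WeierstrassCurve.LFunction_apply_prime_eq_frobeniusTrace W ℓ hgoodℓ]
      exact hf.2 ℓ
    have h := hcong ℓ hℓ hℓN
    rw [hfℓ, map_intCast] at h
    -- `T_ℓ g = a_ℓ(g) g` for the newform `g`
    rw [IsNewform0.heckeEigenvalue_eq_coeff_holds hg hℓ]
    exact h
  · -- `re s > (2 + w)/2 + 1`: the half-plane of absolute convergence, Euler product
    refine IsNewform0.cuspFormLSeries_ne_zero hg ?_
    push_cast
    linarith

/-- **The EDGE companion at `p ≥ 5`** (unconditional): for `W/ℚ` globally minimal with good reduction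
at a prime `p ≥ 5` and `f` its newform, there are `M ∣ N_W` with `p ∤ M`, a newform
`g ∈ S_{p+1}(Γ₀(M))` congruent to `f` modulo `𝔪_{ℚ̄_p}` at every prime `ℓ ∤ N_W` (through some
`ι : ℚ̄_p ≃ ℂ`), and `L(g, p) ≠ 0` — the last critical value of `g` lies in the Euler-product
half-plane `re s > (p+1)/2 + 1` exactly when `p > 3`. The case `w = p − 1` of
`exists_companion_newform_of_isNewformOf`. [cite: DeligneSerreASENS1974, 6.9–6.11]
[cite: DiamondShurman2005, Thm. 5.8.3 and Thm. 5.9.2] -/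
theorem exists_companionEdge_of_isNewformOf_of_five_le (W : WeierstrassCurve ℚ) [W.IsElliptic]
    [W.IsGloballyMinimal] [NeZero (W.conductorNorm ℤ)] (p : ℕ) [Fact p.Prime] (hp5 : 5 ≤ p)
    (hgood : W.HasGoodReductionAtPrime p)
    {f : CuspForm (Gamma0 (W.conductorNorm ℤ)) 2} (hf : IsNewformOf W f) :
    ∃ (M : ℕ) (_ : NeZero M) (_ : M ∣ W.conductorNorm ℤ) (g : CuspForm (Gamma0 M) ((p : ℤ) + 1))
      (ι : PadicAlgCl p ≃+* ℂ),
      IsNewform0 g ∧ ¬ p ∣ M ∧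
      (∀ ℓ : ℕ, ℓ.Prime → ¬ ℓ ∣ W.conductorNorm ℤ →
        ‖ι.symm (heckeEigenvalue g ℓ) - ((W.frobeniusTrace ℓ : ℤ) : PadicAlgCl p)‖ < 1) ∧
      cuspFormLSeries g (p : ℂ) ≠ 0 := by
  have hp : p.Prime := Fact.out
  -- `w = p − 1`: even, `≥ 4`, divisible by `p − 1`
  have hw3 : 3 ≤ p - 1 := by omega
  have hp2 : p ≠ 2 := by omega
  have hwe : Even (p - 1) := hp.even_sub_one hp2
  have hk : (2 : ℤ) + ((p - 1 : ℕ) : ℤ) = (p : ℤ) + 1 := by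
    rw [Nat.cast_sub hp.one_le]
    push_cast
    ring
  obtain ⟨M, hM, hMN, g, ι, hg, hpM, hcong, hL⟩ :=
    exists_companion_newform_of_isNewformOf W p hgood hf hw3 hwe (dvd_refl (p - 1))
  rw [← hk]
  refine ⟨M, hM, hMN, g, ι, hg, hpM, hcong, hL (p : ℂ) ?_⟩
  -- `(p − 1)/2 + 2 < p ⟺ 3 < p`
  have h5 : (5 : ℝ) ≤ (p : ℝ) := by exact_mod_cast hp5
  rw [Complex.natCast_re, Nat.cast_sub hp.one_le, Nat.cast_one]
  linarith

/-- **`stub_companionEdge` of the line card `Lines/edge_seed_rigidity.md` at `p ≥ 5`, granted the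
Modularity Theorem.** The ideator's stub (evidence `Sketch.lean` of item 19001, crux-ideate k1 g14) reads
`∀ W p, p ≠ 2 → ClassX7 W p → a_p = 0 → Surj W p → ∃ M g, IsCompanionForm p W g ∧ L(g, p) ≠ 0` with
`IsCompanionForm p W g := IsNewform0 g ∧ ¬ p ∣ M ∧ M ∣ N_W ∧ IsCongruentFormModP p W g` and
`IsCongruentFormModP p W g := ∃ (ι : ℚ̄_p →+* ℂ) (b : ℕ → ℚ̄_p), ∀ ℓ prime, ℓ ∤ p·M·N_W →
ι (b ℓ) = heckeEigenvalue g ℓ ∧ ‖b ℓ − a_ℓ(W)‖ < 1`; here both definitions are UNFOLDED (they are not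
tree definitions) and `p ≠ 2` is strengthened to `5 ≤ p` (at `p = 3` the weight-`4` companion needs
`E_2`/the Hasse invariant, not in the tree — see the module docstring). The only input beyond proved
theorems is the named fact `exists_isNewformOf` (Breuil–Conrad–Diamond–Taylor 2001, Thm. A), because the
stub does not name the newform of `W`; `ClassX7 W p` is used only through good reduction at `p`, and the
displayed `a_p = 0`, `Surj W p` are idle (S1 does not need them). CONDITIONAL on `hmod`; calibration of
S1 only — the line's engine S2 is not in print. [cite: BreuilConradDiamondTaylor2001, Thm. A]
[cite: DeligneSerreASENS1974, 6.9–6.11] [cite: DiamondShurman2005, Thm. 5.8.3 and Thm. 5.9.2] -/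
theorem stub_companionEdge_of_five_le_of_exists_isNewformOf (hmod : exists_isNewformOf) :
    ∀ (W : WeierstrassCurve ℚ) [W.IsElliptic] [W.IsGloballyMinimal] (p : ℕ) [Fact p.Prime],
      5 ≤ p → ClassX7 W p → W.frobeniusTrace p = 0 → Surj W p →
      ∃ (M : ℕ) (_ : NeZero M) (g : CuspForm (Gamma0 M) ((p : ℤ) + 1)),
        (IsNewform0 g ∧ ¬ (p ∣ M) ∧ M ∣ W.conductorNorm ℤ ∧
          ∃ (ι : PadicAlgCl p →+* ℂ) (b : ℕ → PadicAlgCl p),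
            ∀ ℓ : ℕ, ℓ.Prime → ¬ (ℓ ∣ p * M * W.conductorNorm ℤ) →
              ι (b ℓ) = heckeEigenvalue g ℓ ∧
                ‖b ℓ - (W.frobeniusTrace ℓ : PadicAlgCl p)‖ < 1) ∧
        cuspFormLSeries g (p : ℂ) ≠ 0 := by
  intro W _ _ p _ hp5 hX _ _
  haveI : NeZero (W.conductorNorm ℤ) := ⟨(W.conductorNorm_pos_holds : 0 < W.conductorNorm ℤ).ne'⟩
  -- modularity: the newform `f_W`
  obtain ⟨f, hf⟩ := hmod W
  obtain ⟨M, hM, hMN, g, ι, hg, hpM, hcong, hL⟩ :=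
    exists_companionEdge_of_isNewformOf_of_five_le W p hp5 hX.1.1 hf
  refine ⟨M, hM, g, ⟨hg, hpM, hMN, (ι : PadicAlgCl p →+* ℂ), fun ℓ => ι.symm (heckeEigenvalue g ℓ),
    fun ℓ hℓ hℓpMN => ⟨?_, ?_⟩⟩, hL⟩
  · -- `ι (ι⁻¹ a_ℓ(g)) = a_ℓ(g)`
    exact ι.apply_symm_apply _
  · -- `ℓ ∤ p·M·N ⇒ ℓ ∤ N`
    exact hcong ℓ hℓ fun h => hℓpMN (h.mul_left (p * M))

end Summit.BirchSwinnertonDyer.BirchSwinnertonDyer.Theorems.EdgeSeedRigidity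

end
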